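import Mathlib
import HarnessLib
import Literature.MathematicalPhysics.StatisticalMechanics.ReblockingCounting
import Literature.MathematicalPhysics.StatisticalMechanics.PolymerClosureGainTorus

/-!
# The counting half of [ABKM19] Lemma 9.6: closure gain for general polymers and the nonlinear animal sum

In the reblocked form of the renormalisation map
`K_{k+1}(U) = S_k(H,K)(U) = Σ_{X ∈ 𝓟_k, π(X)=U} Σ_{X₁ ∈ 𝓟_k(X)} (e^{−H̃})^{U∖X} (e^{H̃})^{X∖U} (1−e^{−H̃})^{X₁}
  · R_{k+1}[P₂(e^{−H},K)(X∖X₁)]`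
(`GradientRG.nextKStep_eq_sum`, RenormalisationMapExpansion) every term is small like
`A^{−(2|X₁|_k + |X₂|_k + |𝓒(X₂)|)}`, `X₂ = X ∖ X₁` ([ABKM19] (9.36), with `B = A`), while the target norm
asks for `A^{−|U|_{k+1}}` and a gain.  The gain is geometric ([ABKM19] (9.37)–(9.39), App. A Lemma A.1
= [Bry09] Lemma 6.15): for every connected `k`-polymer `Y` that is not a single block
`|Y|_k ≥ (1+2α)|π(Y)|_{k+1}`, and a single block `Y` has `2|X₁∩Y| + |X₂∩Y| + |𝓒(X₂∩Y)| = 2 = 2|π(Y)|_{k+1}`.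

This file proves the COUNTING statements of that proof on the torus `(ℤ/M)^d`, `M = L·s·t` (odd
sides; `s = L^k`, `π = TorusPolymer.reblock s (L s)`), in the tree's vocabulary:

* `mem_components_of_subset`, `pairwiseDisjoint_blocks_components`, `card_blocks_eq_sum_components` —
  bookkeeping of connected components of a polymer (`|X|_k = Σ_{Y ∈ 𝓒(X)} |Y|_k`);
* `(components X).filter (fun Y => (blocks s Y).card ≤ 1)` — the connected components of `X` that are single `k`-blocks;
* **`gain_reblock_le`** — CLOSURE GAIN FOR GENERAL POLYMERS: for every `k`-polymer `X` and
  `0 ≤ η ≤ 2` not exceeding Brydges' gain, `η |π(X)|_{k+1} ≤ |X|_k + |ib(X)|`;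
* **`card_blocks_add_isolated_le`** — `|X|_k + |ib(X)| ≤ 2|X₁|_k + |X∖X₁|_k + |𝓒(X∖X₁)|`
  for polymers `X₁ ⊆ X`, hence **`gain_reblock_le_exponent`**: `η|π(X)|_{k+1} ≤ 2|X₁|_k + |X₂|_k + |𝓒(X₂)|`
  ([ABKM19] (9.37)–(9.38));
* `subset_thicken_reblock` (`X ⊆ π(X) + [−(2^d−1)L^k, (2^d−1)L^k]^d`, the case `r = 0` of (6.28)),
  `card_blocks_thicken_le`, **`card_filter_reblock_le`** — at most `2^{c(d)|U|_k}` `k`-polymers have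
  `π(X) = U`, and `sum_card_polys_filter_reblock_le` — at most `4^{c(d)|U|_k}` pairs `(X, X₁)`;
* **`sum_reblock_pairs_le`** — the nonlinear animal sum
  `Σ_{π(X)=U} Σ_{X₁ ∈ 𝓟_k(X)} A^{−(2|X₁|_k + |X∖X₁|_k + |𝓒(X∖X₁)|)} ≤ 4^{c(d)|U|_k} · A^{−η|U|_{k+1}}`
  for `A ≥ 1`; **`sum_reblock_pairs_le_pow`** — the same on the renormalisation-group tori `M = L^N`
  with the gain discharged by `closureGain` (PolymerClosureGainTorus), `η(d) = 1 + (2(2^d+1)+6)^{−d}`,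
  in the shape `(4^{c(d)L^d})^{|U|_{k+1}} A^{−η(d)|U|_{k+1}}`.

The analytic half of Lemma 9.6 (the per-term norm bounds) is NOT here; this is the combinatorial
input of the Lipschitz estimate for `S_k` (the crux line's `IsRGStepQ.lipschitz`).  Everything is
proved; no named fact.  Constants `c(d) = (2^{d+1}+2)^d` are not optimised (the source has `3^{|U*|_k}`).

## References
* S. Adams, S. Buchholz, R. Kotecký, S. Müller, *Cauchy–Born rule from microscopic models with
  non-convex potentials*, arXiv:1910.13564, Lemma 9.6 and its proof ((9.33)–(9.39)), App. A Lemma A.1,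
  Ch. 6.3 (6.26)/(6.28) [AdamsBuchholzKoteckyMuller2019].
* D. C. Brydges, *Lectures on the renormalisation group*, IAS/Park City Math. Ser. 16 (2009),
  Lemma 6.15 [Brydges2009].
-/

noncomputable section

namespace Literature.MathematicalPhysics.StatisticalMechanics.TorusPolymer

open scoped BigOperators Classical
open Finset
open Literature.Barriers.CriticalPhenomena.LongRangePhi4.Polymer
  (AdjInf ConnIn IsConn comp components mem_comp comp_subset mem_comp_self isConn_comp
    comp_eq_of_mem eq_biUnion_components comp_disjoint_or_eq)

variable {d M : ℕ} [NeZero M]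

/-! ## Components of a polymer: bookkeeping -/

omit [NeZero M] in
/-- A connected component of `X` contained in an intermediate set `Z ⊆ X` is a connected component of
`Z` (used for: a component of `X` lying in `X₂ = X ∖ X₁` is a component of `X₂`).
[cite: AdamsBuchholzKoteckyMuller2019, proof of Lemma 9.6 ((9.35): components of X₂ ∩ Y)] -/
theorem mem_components_of_subset {X Z Y : Finset (Fin d → ZMod M)} (hY : Y ∈ components X)
    (hYZ : Y ⊆ Z) (hZX : Z ⊆ X) : Y ∈ components Z := by
  obtain ⟨x, hx, rfl⟩ := mem_image.1 hY
  have hxZ : x ∈ Z := hYZ (mem_comp_self hx)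
  refine mem_image.2 ⟨x, hxZ, ?_⟩
  apply Subset.antisymm
  · intro z hz
    obtain ⟨hzZ, hxz⟩ := mem_comp.1 hz
    exact mem_comp.2 ⟨hZX hzZ, hxz.mono hZX⟩
  · intro z hz
    obtain ⟨-, hxz⟩ := mem_comp.1 hz
    exact mem_comp.2 ⟨hYZ hz, (hxz.connIn_comp).mono hYZ⟩

omit [NeZero M] in
/-- Distinct connected components are disjoint. [cite: AdamsBuchholzKoteckyMuller2019, Ch. 6.2 (𝓒(X))] -/
theorem pairwiseDisjoint_components (X : Finset (Fin d → ZMod M)) :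
    ((components X : Finset (Finset (Fin d → ZMod M))) : Set (Finset (Fin d → ZMod M))).PairwiseDisjoint id := by
  intro Y hY Y' hY' hne
  obtain ⟨x, -, rfl⟩ := mem_image.1 (Finset.mem_coe.1 hY)
  obtain ⟨x', -, rfl⟩ := mem_image.1 (Finset.mem_coe.1 hY')
  rcases comp_disjoint_or_eq X x x' with h | h
  · exact absurd h hne
  · exact h

/-- The block families of distinct components of a polymer are disjoint (components of a polymer are
polymers, and a block lies inside every polymer it meets). [cite: AdamsBuchholzKoteckyMuller2019, Ch. 6.2] -/
theorem pairwiseDisjoint_blocks_components (hMo : Odd M) {s : ℕ} (hs : Odd s)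
    {X : Finset (Fin d → ZMod M)} (hX : IsPolymer s X) :
    ((components X : Finset (Finset (Fin d → ZMod M))) : Set (Finset (Fin d → ZMod M))).PairwiseDisjoint
      (blocks s) := by
  intro Y hY Y' hY' hne
  have hYp := (hX.of_mem_components hMo hs (Finset.mem_coe.1 hY)).1
  have hY'p := (hX.of_mem_components hMo hs (Finset.mem_coe.1 hY')).1
  exact hYp.disjoint_blocks hY'p (pairwiseDisjoint_components X hY hY' hne)

/-- `𝓑_k` distributes over indexed unions: `𝓑_k(⋃_i X_i) = ⋃_i 𝓑_k(X_i)`.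
[cite: AdamsBuchholzKoteckyMuller2019, Ch. 6.2] -/
theorem blocks_biUnion {ι : Type*} (s : ℕ) (S : Finset ι) (f : ι → Finset (Fin d → ZMod M)) :
    blocks s (S.biUnion f) = S.biUnion fun i => blocks s (f i) := by
  rw [blocks, Finset.biUnion_image]
  rfl

/-- The blocks of a set are the blocks of its components: `𝓑_k(X) = ⋃_{Y ∈ 𝓒(X)} 𝓑_k(Y)`.
[cite: AdamsBuchholzKoteckyMuller2019, Ch. 6.2] -/
theorem blocks_eq_biUnion_components (s : ℕ) (X : Finset (Fin d → ZMod M)) :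
    blocks s X = (components X).biUnion (blocks s) := by
  conv_lhs => rw [eq_biUnion_components X]
  rw [blocks_biUnion]
  rfl

/-- **`|X|_k = Σ_{Y ∈ 𝓒(X)} |Y|_k`** for a `k`-polymer `X` (odd torus, odd block side).
[cite: AdamsBuchholzKoteckyMuller2019, proof of Lemma 9.6 ((9.37): |X₁∩Y| + |X₂∩Y| = |Y| summed over 𝓒(X))] -/
theorem card_blocks_eq_sum_components (hMo : Odd M) {s : ℕ} (hs : Odd s)
    {X : Finset (Fin d → ZMod M)} (hX : IsPolymer s X) :
    (blocks s X).card = ∑ Y ∈ components X, (blocks s Y).card := by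
  rw [blocks_eq_biUnion_components s X, card_biUnion (pairwiseDisjoint_blocks_components hMo hs hX)]

/-- The blocks of a sub-union `π(X) = ⋃_{Y ∈ 𝓒(X)} π(Y)` are counted by the components:
`|π(X)|_{k+1} ≤ Σ_{Y ∈ 𝓒(X)} |π(Y)|_{k+1}`. [cite: AdamsBuchholzKoteckyMuller2019, proof of Lemma 9.6 ("|π(X)|_{k+1} ≤ Σ_{Y ∈ 𝓒(X)} |π(Y)|_{k+1}")] -/
theorem card_blocks_reblock_le_sum (s s' : ℕ) (X : Finset (Fin d → ZMod M)) :
    (blocks s' (reblock s s' X)).card ≤ ∑ Y ∈ components X, (blocks s' (reblock s s' Y)).card := by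
  rw [reblock_eq_biUnion_components s s' X, blocks_biUnion]
  exact card_biUnion_le

/-! ## Isolated blocks -/

/-- An isolated block of a polymer is a block: `Y = B_y` for each of its points.
[cite: AdamsBuchholzKoteckyMuller2019, proof of Lemma 9.6 (9.38)] -/
theorem eq_blockOf_of_mem_isolatedBlocks (hMo : Odd M) {s : ℕ} (hs : Odd s)
    {X Y : Finset (Fin d → ZMod M)} (hX : IsPolymer s X) (hY : Y ∈ (components X).filter (fun Y => (blocks s Y).card ≤ 1))
    {y : Fin d → ZMod M} (hy : y ∈ Y) : Y = blockOf s y := by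
  obtain ⟨hYc, hY1⟩ := mem_filter.1 hY
  have hYp := (hX.of_mem_components hMo hs hYc).1
  have hB : blockOf s y ∈ blocks s Y := mem_blocks.2 ⟨y, hy, rfl⟩
  have hbl : blocks s Y = {blockOf s y} := by
    apply Finset.eq_singleton_iff_unique_mem.2 ⟨hB, fun B hB' => ?_⟩
    exact (Finset.card_le_one.1 hY1) B hB' _ hB
  have := hYp.biUnion_blocks
  rw [hbl, singleton_biUnion] at this
  exact this.symm

/-! ## Closure gain for general polymers -/

/-- **Closure gain for one connected polymer, with the block defect**: for a connected non-empty
`k`-polymer `Y` and `0 ≤ η ≤ 2` not exceeding the gain of large connected polymers,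
`η |π(Y)|_{k+1} ≤ |Y|_k + [ |Y|_k ≤ 1 ]` — large `Y`: `π(Y) = Ȳ` and Brydges' gain; small `Y` with at
least two blocks: `π(Y)` is one block and `η ≤ 2 ≤ |Y|_k`; a single block: `η ≤ 1 + 1`.
[cite: AdamsBuchholzKoteckyMuller2019, App. A Lemma A.1 / proof of Lemma 9.6 (9.37)–(9.38)] -/
theorem gain_reblock_le_of_isConn {s L : ℕ} {η : ℝ} (hη2 : η ≤ 2)
    (hgain : ∀ X : Finset (Fin d → ZMod M), IsPolymer s X → IsConn X → 2 ^ d < (blocks s X).card →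
      η * ((blocks (L * s) (closure (L * s) X)).card : ℝ) ≤ (blocks s X).card)
    {Y : Finset (Fin d → ZMod M)} (hY : IsPolymer s Y) (hYc : IsConn Y) :
    η * ((blocks (L * s) (reblock s (L * s) Y)).card : ℝ) ≤
      (blocks s Y).card + (if (blocks s Y).card ≤ 1 then (1 : ℝ) else 0) := by
  by_cases hsmall : (blocks s Y).card ≤ 2 ^ d
  · obtain ⟨x, -, hπ⟩ := reblock_of_isConn_of_card_le s (L * s) hYc hsmall
    rw [hπ, blocks_blockOf, card_singleton, Nat.cast_one, mul_one]
    have h1 : 1 ≤ (blocks s Y).card := by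
      obtain ⟨y, hy⟩ := hYc.1
      exact card_pos.2 ⟨blockOf s y, mem_blocks.2 ⟨y, hy, rfl⟩⟩
    by_cases hone : (blocks s Y).card ≤ 1
    · rw [if_pos hone]
      have : ((blocks s Y).card : ℝ) = 1 := by exact_mod_cast le_antisymm hone h1
      linarith
    · rw [if_neg hone, add_zero]
      have : (2 : ℝ) ≤ (blocks s Y).card := by exact_mod_cast (not_le.1 hone)
      linarith
  · rw [reblock_of_isConn_of_lt_card s (L * s) hYc (not_le.1 hsmall)]
    have hone : ¬ (blocks s Y).card ≤ 1 := fun h =>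
      hsmall (h.trans (Nat.one_le_two_pow))
    rw [if_neg hone, add_zero]
    exact hgain Y hY hYc (not_le.1 hsmall)

/-- **Closure gain for general polymers** ([ABKM19] App. A Lemma A.1 summed over components): for
every `k`-polymer `X` on the torus `M = L·s·t` (odd sides) and every `0 ≤ η ≤ 2` not exceeding the
gain of large connected polymers,
`η |π(X)|_{k+1} ≤ |X|_k + #{Y ∈ 𝓒(X) : |Y|_k ≤ 1}` (the isolated blocks of `X`).
[cite: AdamsBuchholzKoteckyMuller2019, App. A Lemma A.1; proof of Lemma 9.6 (9.37)–(9.39)] -/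
theorem gain_reblock_le {s L t : ℕ} (hM : M = L * s * t) (hs : Odd s) (hL : Odd L) (ht : Odd t)
    {η : ℝ} (hη0 : 0 ≤ η) (hη2 : η ≤ 2)
    (hgain : ∀ X : Finset (Fin d → ZMod M), IsPolymer s X → IsConn X → 2 ^ d < (blocks s X).card →
      η * ((blocks (L * s) (closure (L * s) X)).card : ℝ) ≤ (blocks s X).card)
    {X : Finset (Fin d → ZMod M)} (hX : IsPolymer s X) :
    η * ((blocks (L * s) (reblock s (L * s) X)).card : ℝ) ≤
      (blocks s X).card + ((components X).filter (fun Y => (blocks s Y).card ≤ 1)).card := by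
  have hMo : Odd M := by rw [hM]; exact (hL.mul hs).mul ht
  have h1 : η * ((blocks (L * s) (reblock s (L * s) X)).card : ℝ) ≤
      ∑ Y ∈ components X, η * ((blocks (L * s) (reblock s (L * s) Y)).card : ℝ) := by
    rw [← mul_sum]
    refine mul_le_mul_of_nonneg_left ?_ hη0
    exact_mod_cast card_blocks_reblock_le_sum s (L * s) X
  have h2 : ∀ Y ∈ components X, η * ((blocks (L * s) (reblock s (L * s) Y)).card : ℝ) ≤
      (blocks s Y).card + (if (blocks s Y).card ≤ 1 then (1 : ℝ) else 0) := by
    intro Y hY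
    obtain ⟨hYp, hYc⟩ := hX.of_mem_components hMo hs hY
    exact gain_reblock_le_of_isConn hη2 hgain hYp hYc
  refine h1.trans ((sum_le_sum h2).trans (le_of_eq ?_))
  rw [sum_add_distrib, card_blocks_eq_sum_components hMo hs hX, Finset.card_filter]
  push_cast
  rfl

/-! ## The exponent of Lemma 9.6: `2|X₁|_k + |X₂|_k + |𝓒(X₂)|` -/

/-- **Isolated blocks are paid for by `X₁` or by the components of `X₂`**: for polymers `X₁ ⊆ X` and
`X₂ = X ∖ X₁`, every isolated block of `X` is either a block of `X₁` or a connected component of `X₂`,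
so `#{isolated blocks of X} ≤ |X₁|_k + |𝓒(X₂)|`. [cite: AdamsBuchholzKoteckyMuller2019, proof of Lemma 9.6 (9.38) ("either Y ⊆ X₁ or Y ⊆ X₂")] -/
theorem card_isolatedBlocks_le (hMo : Odd M) {s : ℕ} (hs : Odd s) {X X₁ : Finset (Fin d → ZMod M)}
    (hX : IsPolymer s X) (hX₁ : X₁ ∈ polys s X) :
    ((components X).filter (fun Y => (blocks s Y).card ≤ 1)).card ≤ (blocks s X₁).card + (components (X \ X₁)).card := by
  obtain ⟨hX₁X, hX₁p⟩ := mem_polys.1 hX₁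
  rw [← card_filter_add_card_filter_not (s := (components X).filter (fun Y => (blocks s Y).card ≤ 1)) (fun Y => Y ⊆ X₁)]
  refine add_le_add (card_le_card fun Y hY => ?_) (card_le_card fun Y hY => ?_)
  · obtain ⟨hYI, hYX₁⟩ := mem_filter.1 hY
    obtain ⟨hne, -⟩ := nonempty_of_mem_components (mem_filter.1 hYI).1
    obtain ⟨y, hy⟩ := hne
    rw [eq_blockOf_of_mem_isolatedBlocks hMo hs hX hYI hy]
    exact mem_blocks.2 ⟨y, hYX₁ hy, rfl⟩
  · obtain ⟨hYI, hYX₁⟩ := mem_filter.1 hY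
    have hYc := (mem_filter.1 hYI).1
    obtain ⟨hne, hYX⟩ := nonempty_of_mem_components hYc
    obtain ⟨y, hy⟩ := hne
    have hYB := eq_blockOf_of_mem_isolatedBlocks hMo hs hX hYI hy
    -- `Y` misses `X₁`: a point of the block `Y` in the polymer `X₁` would put all of `Y` in `X₁`
    have hY2 : Y ⊆ X \ X₁ := by
      intro z hz
      refine mem_sdiff.2 ⟨hYX hz, fun hzX₁ => hYX₁ ?_⟩
      have h1 : blockOf s z ⊆ X₁ := hX₁p z hzX₁
      have h2 : blockOf s z = Y := by rw [hYB]; exact blockOf_eq_of_mem (by rw [← hYB]; exact hz)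
      rw [← h2]; exact h1
    exact mem_components_of_subset hYc hY2 sdiff_subset

/-- For polymers `X₁ ⊆ X`: `|X|_k = |X₁|_k + |X ∖ X₁|_k`. [cite: AdamsBuchholzKoteckyMuller2019, Ch. 6.2] -/
theorem card_blocks_eq_add_sdiff {s : ℕ} {X X₁ : Finset (Fin d → ZMod M)} (hX : IsPolymer s X)
    (hX₁ : X₁ ∈ polys s X) : (blocks s X).card = (blocks s X₁).card + (blocks s (X \ X₁)).card := by
  obtain ⟨hX₁X, hX₁p⟩ := mem_polys.1 hX₁
  rw [hX.blocks_sdiff hX₁p hX₁X]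
  have := card_sdiff_add_card_eq_card (blocks_mono s hX₁X)
  omega

/-- **`|X|_k + #{isolated blocks of X} ≤ 2|X₁|_k + |X₂|_k + |𝓒(X₂)|`** for polymers `X₁ ⊆ X`, `X₂ = X ∖ X₁`.
[cite: AdamsBuchholzKoteckyMuller2019, proof of Lemma 9.6 (9.37)–(9.38)] -/
theorem card_blocks_add_isolated_le (hMo : Odd M) {s : ℕ} (hs : Odd s) {X X₁ : Finset (Fin d → ZMod M)}
    (hX : IsPolymer s X) (hX₁ : X₁ ∈ polys s X) :
    (blocks s X).card + ((components X).filter (fun Y => (blocks s Y).card ≤ 1)).card ≤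
      2 * (blocks s X₁).card + (blocks s (X \ X₁)).card + (components (X \ X₁)).card := by
  have h1 := card_isolatedBlocks_le hMo hs hX hX₁
  have h2 := card_blocks_eq_add_sdiff hX hX₁
  omega

/-- **The exponent inequality of Lemma 9.6** ([ABKM19] (9.37)–(9.38) summed as in (9.39)): for every
`k`-polymer `X` with the polymer `X₁ ⊆ X` and `X₂ = X ∖ X₁`, and every `0 ≤ η ≤ 2` not exceeding the
gain of large connected polymers, `η |π(X)|_{k+1} ≤ 2|X₁|_k + |X₂|_k + |𝓒(X₂)|`.
[cite: AdamsBuchholzKoteckyMuller2019, proof of Lemma 9.6 (9.37)–(9.39)] -/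
theorem gain_reblock_le_exponent {s L t : ℕ} (hM : M = L * s * t) (hs : Odd s) (hL : Odd L) (ht : Odd t)
    {η : ℝ} (hη0 : 0 ≤ η) (hη2 : η ≤ 2)
    (hgain : ∀ X : Finset (Fin d → ZMod M), IsPolymer s X → IsConn X → 2 ^ d < (blocks s X).card →
      η * ((blocks (L * s) (closure (L * s) X)).card : ℝ) ≤ (blocks s X).card)
    {X X₁ : Finset (Fin d → ZMod M)} (hX : IsPolymer s X) (hX₁ : X₁ ∈ polys s X) :
    η * ((blocks (L * s) (reblock s (L * s) X)).card : ℝ) ≤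
      ((2 * (blocks s X₁).card + (blocks s (X \ X₁)).card + (components (X \ X₁)).card : ℕ) : ℝ) := by
  have hMo : Odd M := by rw [hM]; exact (hL.mul hs).mul ht
  refine (gain_reblock_le hM hs hL ht hη0 hη2 hgain hX).trans ?_
  exact_mod_cast card_blocks_add_isolated_le hMo hs hX hX₁

/-! ## Localisation and counting of the polymers with `π(X) = U` -/

/-- **`X ⊆ π(X) + [−(2^d−1)L^k, (2^d−1)L^k]^d`** for every `k`-polymer `X` (the case `r = 0` of (6.28)).
[cite: AdamsBuchholzKoteckyMuller2019, Ch. 6.3 (6.28) / proof of Lemma 9.6 ("X ⊆ U*")] -/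
theorem subset_thicken_reblock {s t' L : ℕ} (hMst : M = s * t') (hs : Odd s) (ht' : Odd t') (hL : Odd L)
    (X : Finset (Fin d → ZMod M)) : X ⊆ thicken ((2 ^ d - 1) * s) (reblock s (L * s) X) := by
  have h := thicken_subset_thicken_reblock hMst hs ht' hL (r := 0) (r' := (2 ^ d - 1) * s)
    (Nat.zero_le _) (by omega) X
  rwa [thicken_zero] at h

/-- The `r`-thickening of a block of side `s` meets at most `(2⌊(r+s−1)/s⌋ + 4)^d` blocks.
[cite: AdamsBuchholzKoteckyMuller2019, proof of Lemma 9.6 ((9.33): |U*|_k ≤ 2|U|_k)] -/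
theorem card_blocks_thicken_blockOf_le {s t' : ℕ} (hMst : M = s * t') (hs : Odd s) (ht' : Odd t') (r : ℕ)
    (x : Fin d → ZMod M) :
    (blocks s (thicken r (blockOf s x))).card ≤ (2 * ((r + (s - 1)) / s) + 4) ^ d := by
  refine card_blocks_le_of_subset_ball hMst hs ht' (c := x) fun y hy => ?_
  obtain ⟨b, hb, hyb⟩ := mem_thicken.1 hy
  have hbx : GradientFRD.supNorm (b - x) ≤ s - 1 := by
    rw [supNorm_sub_comm]
    exact supNorm_sub_le_of_sameBlock hs (mem_blockOf.1 hb)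
  exact (supNorm_sub_le y b x).trans (by omega)

/-- **`|U⁺|_k ≤ c(d)|U|_k`** with `U⁺ = U + [−(2^d−1)L^k, (2^d−1)L^k]^d` (any set `U`).
[cite: AdamsBuchholzKoteckyMuller2019, proof of Lemma 9.6 ((9.33): |U*|_k ≤ 2|U|_k)] -/
theorem card_blocks_thicken_le {s t' : ℕ} (hMst : M = s * t') (hs : Odd s) (ht' : Odd t')
    (U : Finset (Fin d → ZMod M)) :
    (blocks s (thicken ((2 ^ d - 1) * s) U)).card ≤ (2 ^ (d + 1) + 2) ^ d * (blocks s U).card := by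
  set r := (2 ^ d - 1) * s with hr
  -- `U ⊆ ⋃ 𝓑_k(U)`, thickening and blocks distribute over the union
  have hUsub : U ⊆ (blocks s U).biUnion id := fun u hu =>
    mem_biUnion.2 ⟨blockOf s u, mem_blocks.2 ⟨u, hu, rfl⟩, mem_blockOf_self s u⟩
  have h1 : blocks s (thicken r U) ⊆ (blocks s U).biUnion fun B => blocks s (thicken r B) := by
    refine (blocks_mono s (thicken_mono r hUsub)).trans ?_
    rw [thicken_biUnion, blocks_biUnion]
    exact Subset.rfl
  refine (card_le_card h1).trans (card_biUnion_le.trans ?_)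
  have hq : 2 * ((r + (s - 1)) / s) + 4 ≤ 2 ^ (d + 1) + 2 := by
    have hs0 : 0 < s := hs.pos
    have h2d : 1 ≤ 2 ^ d := Nat.one_le_two_pow
    have hlt : (r + (s - 1)) / s < 2 ^ d := by
      rw [Nat.div_lt_iff_lt_mul hs0, hr]
      have : (2 ^ d - 1) * s + s = 2 ^ d * s := by
        rw [← Nat.succ_mul]; congr 1; omega
      omega
    have : 2 ^ (d + 1) = 2 * 2 ^ d := by rw [pow_succ, mul_comm]
    omega
  have hterm : ∀ B ∈ blocks s U, (blocks s (thicken r B)).card ≤ (2 ^ (d + 1) + 2) ^ d := by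
    intro B hB
    obtain ⟨x, -, rfl⟩ := mem_blocks.1 hB
    exact (card_blocks_thicken_blockOf_le hMst hs ht' r x).trans (Nat.pow_le_pow_left hq d)
  refine (sum_le_card_nsmul _ _ _ hterm).trans ?_
  rw [smul_eq_mul, mul_comm]

/-- **At most `2^{c(d)|U|_k}` `k`-polymers `X` have `π(X) = U`** (they lie in `U⁺`).
[cite: AdamsBuchholzKoteckyMuller2019, proof of Lemma 9.6 ("3^{|U*|_k} possibilities")] -/
theorem card_filter_reblock_le {s L t : ℕ} (hM : M = L * s * t) (hs : Odd s) (hL : Odd L) (ht : Odd t)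
    (U : Finset (Fin d → ZMod M)) :
    ((polys s univ).filter fun X => reblock s (L * s) X = U).card ≤
      2 ^ ((2 ^ (d + 1) + 2) ^ d * (blocks s U).card) := by
  have hMst : M = s * (L * t) := by rw [hM]; ring
  have hsub : (polys s univ).filter (fun X => reblock s (L * s) X = U) ⊆ polys s (thicken ((2 ^ d - 1) * s) U) := by
    intro X hX
    obtain ⟨hXp, hXU⟩ := mem_filter.1 hX
    refine mem_polys.2 ⟨?_, (mem_polys.1 hXp).2⟩
    rw [← hXU]
    exact subset_thicken_reblock hMst hs (hL.mul ht) hL X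
  refine (card_le_card hsub).trans ((card_polys_le_two_pow s _).trans ?_)
  exact Nat.pow_le_pow_right (by norm_num) (card_blocks_thicken_le hMst hs (hL.mul ht) U)

/-- **At most `4^{c(d)|U|_k}` pairs `(X, X₁)`** with `π(X) = U` and `X₁ ∈ 𝓟_k(X)`.
[cite: AdamsBuchholzKoteckyMuller2019, proof of Lemma 9.6 ("3^{|U*|_k} possibilities")] -/
theorem sum_card_polys_filter_reblock_le {s L t : ℕ} (hM : M = L * s * t) (hs : Odd s) (hL : Odd L)
    (ht : Odd t) (U : Finset (Fin d → ZMod M)) :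
    ∑ X ∈ (polys s univ).filter (fun X => reblock s (L * s) X = U), (polys s X).card ≤
      4 ^ ((2 ^ (d + 1) + 2) ^ d * (blocks s U).card) := by
  have hMst : M = s * (L * t) := by rw [hM]; ring
  set N := (2 ^ (d + 1) + 2) ^ d * (blocks s U).card with hN
  have hterm : ∀ X ∈ (polys s univ).filter (fun X => reblock s (L * s) X = U), (polys s X).card ≤ 2 ^ N := by
    intro X hX
    obtain ⟨-, hXU⟩ := mem_filter.1 hX
    refine (card_polys_le_two_pow s X).trans (Nat.pow_le_pow_right (by norm_num) ?_)
    have hXsub : X ⊆ thicken ((2 ^ d - 1) * s) U := by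
      rw [← hXU]; exact subset_thicken_reblock hMst hs (hL.mul ht) hL X
    exact (card_le_card (blocks_mono s hXsub)).trans (card_blocks_thicken_le hMst hs (hL.mul ht) U)
  refine (sum_le_card_nsmul _ _ _ hterm).trans ?_
  rw [smul_eq_mul]
  calc ((polys s univ).filter fun X => reblock s (L * s) X = U).card * 2 ^ N
      ≤ 2 ^ N * 2 ^ N := Nat.mul_le_mul_right _ (card_filter_reblock_le hM hs hL ht U)
    _ = 4 ^ N := by rw [← mul_pow]; norm_num

/-! ## The nonlinear animal sum of Lemma 9.6 -/

/-- One term: if `η n ≤ m` and `A ≥ 1` then `A^{−m} ≤ A^{−η n}`. [cite: AdamsBuchholzKoteckyMuller2019, proof of Lemma 9.6 (9.39)] -/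
theorem inv_pow_le_rpow_of_gain {A η : ℝ} (hA : 1 ≤ A) {n m : ℕ} (hgain : η * n ≤ m) :
    (A ^ m)⁻¹ ≤ A ^ (-(η * n) : ℝ) := by
  have hA0 : 0 < A := by linarith
  have h1 : A ^ (η * n : ℝ) ≤ (A ^ m : ℝ) := by
    rw [← Real.rpow_natCast A m]
    exact Real.rpow_le_rpow_of_exponent_le hA hgain
  rw [Real.rpow_neg hA0.le]
  exact inv_anti₀ (Real.rpow_pos_of_pos hA0 _) h1

/-- **The nonlinear animal sum of [ABKM19] Lemma 9.6**: on the torus `M = L·s·t` (odd sides), for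
`A ≥ 1`, `0 ≤ η ≤ 2` not exceeding the gain of large connected `k`-polymers, and any set `U`,
`Σ_{X ∈ 𝓟_k, π(X)=U} Σ_{X₁ ∈ 𝓟_k(X)} A^{−(2|X₁|_k + |X∖X₁|_k + |𝓒(X∖X₁)|)} ≤ 4^{c(d)|U|_k} · A^{−η|U|_{k+1}}`.
[cite: AdamsBuchholzKoteckyMuller2019, Lemma 9.6 (proof, (9.36)–(9.39))] -/
theorem sum_reblock_pairs_le {s L t : ℕ} (hM : M = L * s * t) (hs : Odd s) (hL : Odd L) (ht : Odd t)
    {A η : ℝ} (hA : 1 ≤ A) (hη0 : 0 ≤ η) (hη2 : η ≤ 2)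
    (hgain : ∀ X : Finset (Fin d → ZMod M), IsPolymer s X → IsConn X → 2 ^ d < (blocks s X).card →
      η * ((blocks (L * s) (closure (L * s) X)).card : ℝ) ≤ (blocks s X).card)
    (U : Finset (Fin d → ZMod M)) :
    ∑ X ∈ (polys s univ).filter (fun X => reblock s (L * s) X = U), ∑ X₁ ∈ polys s X,
        (A ^ (2 * (blocks s X₁).card + (blocks s (X \ X₁)).card + (components (X \ X₁)).card))⁻¹ ≤
      (4 : ℝ) ^ ((2 ^ (d + 1) + 2) ^ d * (blocks s U).card) * A ^ (-(η * (blocks (L * s) U).card) : ℝ) := by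
  have hA0 : 0 < A := by linarith
  set T := (polys s univ).filter (fun X => reblock s (L * s) X = U) with hT
  have hterm : ∀ X ∈ T, ∑ X₁ ∈ polys s X,
      (A ^ (2 * (blocks s X₁).card + (blocks s (X \ X₁)).card + (components (X \ X₁)).card))⁻¹ ≤
        ((polys s X).card : ℝ) * A ^ (-(η * (blocks (L * s) U).card) : ℝ) := by
    intro X hX
    obtain ⟨hXp, hXU⟩ := mem_filter.1 hX
    have hXP : IsPolymer s X := (mem_polys.1 hXp).2
    have h1 : ∀ X₁ ∈ polys s X,
        (A ^ (2 * (blocks s X₁).card + (blocks s (X \ X₁)).card + (components (X \ X₁)).card))⁻¹ ≤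
          A ^ (-(η * (blocks (L * s) U).card) : ℝ) := by
      intro X₁ hX₁
      refine inv_pow_le_rpow_of_gain hA ?_
      have := gain_reblock_le_exponent hM hs hL ht hη0 hη2 hgain hXP hX₁
      rwa [hXU] at this
    refine (sum_le_card_nsmul _ _ _ h1).trans ?_
    rw [nsmul_eq_mul]
  refine (sum_le_sum hterm).trans ?_
  rw [← sum_mul]
  refine mul_le_mul_of_nonneg_right ?_ (Real.rpow_nonneg hA0.le _)
  have := sum_card_polys_filter_reblock_le hM hs hL ht U
  exact_mod_cast this

/-- **The animal sum of Lemma 9.6 on the renormalisation-group tori `M = L^N`, gain discharged**: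
`L` odd, `L ≥ 2^d + 1`, `L ≥ 4`, scale `k + 1 ≤ N` (`s = L^k`), `A ≥ 1`, `U` a `(k+1)`-polymer; with
Brydges' `η(d) = 1 + (2(2^d+1)+6)^{−d}` (`closureGain`) and `c(d) = (2^{d+1}+2)^d`:
`Σ_{π(X)=U} Σ_{X₁ ∈ 𝓟_k(X)} A^{−(2|X₁|_k + |X∖X₁|_k + |𝓒(X∖X₁)|)} ≤ (4^{c(d)L^d})^{|U|_{k+1}} · A^{−η(d)|U|_{k+1}}`
— i.e. `≤ (4^{c(d)L^d} A^{−(η(d)−1)})^{|U|_{k+1}} A^{−|U|_{k+1}}`, the shape of [ABKM19] (9.39).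
[cite: AdamsBuchholzKoteckyMuller2019, Lemma 9.6 (9.39); Brydges2009, Lemma 6.15] -/
theorem sum_reblock_pairs_le_pow {L N k : ℕ} (hLodd : Odd L) (hL2 : 2 ^ d + 1 ≤ L) (hL4 : 4 ≤ L)
    (hM : M = L ^ N) (hkN : k + 1 ≤ N) {A : ℝ} (hA : 1 ≤ A) {U : Finset (Fin d → ZMod M)}
    (hU : IsPolymer (L * L ^ k) U) :
    ∑ X ∈ (polys (L ^ k) univ).filter (fun X => reblock (L ^ k) (L * L ^ k) X = U), ∑ X₁ ∈ polys (L ^ k) X,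
        (A ^ (2 * (blocks (L ^ k) X₁).card + (blocks (L ^ k) (X \ X₁)).card +
          (components (X \ X₁)).card))⁻¹ ≤
      ((4 : ℝ) ^ ((2 ^ (d + 1) + 2) ^ d * L ^ d)) ^ (blocks (L * L ^ k) U).card *
        A ^ (-((1 + 1 / ((2 * (2 ^ d + 1) + 6 : ℝ) ^ d)) * (blocks (L * L ^ k) U).card) : ℝ) := by
  have hMeq : M = L * L ^ k * L ^ (N - k - 1) := by
    rw [hM, ← pow_succ', ← pow_add]; congr 1; omega
  have ht3 : L ^ (N - k - 1) ≠ 3 := by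
    rcases Nat.eq_zero_or_pos (N - k - 1) with h0 | h0
    · rw [h0, pow_zero]; norm_num
    · intro h3
      have : L ≤ L ^ (N - k - 1) := Nat.le_self_pow (by omega) L
      omega
  set η : ℝ := 1 + 1 / ((2 * (2 ^ d + 1) + 6 : ℝ) ^ d) with hη
  have hη0 : 0 ≤ η := by positivity
  have hη2 : η ≤ 2 := by
    have h1 : (1 : ℝ) ≤ ((2 * (2 ^ d + 1) + 6 : ℝ) ^ d) :=
      one_le_pow₀ (by have : (0 : ℝ) ≤ 2 ^ d := by positivity
                      linarith)
    have : 1 / ((2 * (2 ^ d + 1) + 6 : ℝ) ^ d) ≤ 1 := by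
      rw [div_le_one (by positivity)]; exact h1
    linarith
  have hgain : ∀ X : Finset (Fin d → ZMod M), IsPolymer (L ^ k) X → IsConn X →
      2 ^ d < (blocks (L ^ k) X).card →
        η * ((blocks (L * L ^ k) (closure (L * L ^ k) X)).card : ℝ) ≤ (blocks (L ^ k) X).card :=
    fun X hX hc hlarge => closureGain hMeq hLodd.pow hLodd hLodd.pow ht3 hL2 hX hc hlarge
  refine (sum_reblock_pairs_le hMeq hLodd.pow hLodd hLodd.pow hA hη0 hη2 hgain U).trans (le_of_eq ?_)
  rw [card_blocks_eq_mul hMeq hLodd.pow hLodd hLodd.pow hU, ← mul_assoc, pow_mul]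

end Literature.MathematicalPhysics.StatisticalMechanics.TorusPolymer

end
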